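import Summits.QuantumFields.GaugeBoot.SquareSmoothing
import HarnessLib

/-!
# Square-positive functionals on a translation-finite dense function algebra of a compact group: `inf f ≤ φ f ≤ sup f` (gauge-boot, L1 supplement)

HONEST FRAMING (cell `pub-gaugeboot`, page 1 of every file): the venture produces certified bounds
on lattice expectations at stated coupling, gauge group, dimension and torus size; NOT a mass gap,
NOT a continuum limit, NOT a string tension; NOT Yang–Mills-summit-bearing (barriers
`FixedCouplingUltralocality`, `PerturbativeInvisibility`). Structural; it certifies no number.

## Content (second half of "positivity ⇒ realisability" for the lattice bootstrap)

`Ω` compact Hausdorff second-countable group, `A ≤ C(Ω, ℝ)` DENSE and translation finite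
(`SquareSmoothing.lean`), `φ : C(Ω, ℝ) →ₗ[ℝ] ℝ` NORMALISED (`φ 1 = 1`) and SQUARE-POSITIVE ON `A`
(`0 ≤ φ (a a)`, `a ∈ A` — "all moment matrices positive semi-definite"). Then for `f ∈ A`:

* ★★ `le_of_sqPositive` / `sqPositive_le` — `inf f ≤ φ f ≤ sup f`; hence
  `abs_le_norm_of_sqPositive` (`|φ f| ≤ ‖f‖`, automatic continuity) and `nonneg_of_sqPositive`.

Steps: `exists_sqKernel_concentrated` — bumps `a ∈ A` whose weight `a(w⁻¹)²` concentrates at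
`1` (Urysohn + density; open sets have positive Haar measure); `exists_smooth_approx` —
`|φ(T_a f) - (∫ q_a) φ f| ≤ ε ∫ q_a` (right translation is norm continuous; `T_a f, f` lie in the
finite-dimensional `W` where `φ` is continuous); and the smoothing identity
`φ(T_a f) = ∫ f P_a ≥ (inf f) ∫ P_a` of `SquareSmoothing.lean`.

References: Berg–Christensen–Ressel (1984) §4.2/§4.5; Anderson–Kruczenski (2017); Kazakov–Zheng
arXiv:2203.11360; Li–Zhou arXiv:2404.17071. Folklore harmonic analysis.
-/

noncomputable section

open MeasureTheory Filter Topology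
open Literature.MathematicalPhysics.QuantumFieldTheory (haarProbability)

namespace Summit.QuantumFields.GaugeBoot

variable {Ω : Type*} [Group Ω] [TopologicalSpace Ω] [IsTopologicalGroup Ω] [CompactSpace Ω]
  [MeasurableSpace Ω] [BorelSpace Ω] [SecondCountableTopology Ω] [T2Space Ω]
  {A : Subalgebra ℝ C(Ω, ℝ)}

/-! ## Bumps in `A`: an approximate identity made of squares -/

/-- **Polynomial bumps.** `A` dense: for every open neighbourhood `U` of `1` and `t > 0` there is
`a ∈ A` whose smoothing weight `q_a(w) = a(w⁻¹)²` has positive mass and puts at most the fraction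
`t` of it outside `U` (Urysohn bump at `1`, approximated from `A`; open sets have positive Haar
measure). [folklore] -/
theorem exists_sqKernel_concentrated (hd : ∀ f : C(Ω, ℝ), f ∈ closure (A : Set C(Ω, ℝ)))
    {U : Set Ω} (hUo : IsOpen U) (h1U : (1 : Ω) ∈ U) {t : ℝ} (ht : 0 < t) :
    ∃ a ∈ A, 0 < ∫ w, sqKernel a w ∂haarProbability Ω ∧
      ∫ w in Uᶜ, sqKernel a w ∂haarProbability Ω ≤ t * ∫ w, sqKernel a w ∂haarProbability Ω := by
  -- an open `O ∋ 1` inside `U⁻¹`, and an Urysohn function for `{1} ⊆ O`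
  have hUinv : U⁻¹ ∈ 𝓝 (1 : Ω) := inv_mem_nhds_one Ω (hUo.mem_nhds h1U)
  have hOo : IsOpen (interior U⁻¹) := isOpen_interior
  have h1O : (1 : Ω) ∈ interior U⁻¹ := mem_interior_iff_mem_nhds.2 hUinv
  obtain ⟨g, hg0, hg1, -⟩ := exists_continuous_zero_one_of_isClosed hOo.isClosed_compl
    (isClosed_singleton (x := (1 : Ω))) (Set.disjoint_singleton_right.2 fun h => h h1O)
  have hg1' : g 1 = 1 := by simpa using hg1 (Set.mem_singleton (1 : Ω))
  -- the open set `V ∋ 1` where `g(w⁻¹) > 1/2` has positive Haar measure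
  set V : Set Ω := {w | (1 / 2 : ℝ) < g w⁻¹} with hV
  have hVo : IsOpen V := isOpen_lt continuous_const (g.continuous.comp continuous_inv)
  have h1V : (1 : Ω) ∈ V := by
    simp only [hV, Set.mem_setOf_eq, inv_one, hg1']
    norm_num
  have hVpos : 0 < (haarProbability Ω).real V :=
    ENNReal.toReal_pos (hVo.measure_pos (haarProbability Ω) ⟨1, h1V⟩).ne' (measure_ne_top _ _)
  -- approximation parameter
  set c : ℝ := t * (haarProbability Ω).real V / 16 with hc
  have hcpos : 0 < c := by positivity
  set s₀ : ℝ := min (1 / 4) c with hs₀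
  have hs₀pos : 0 < s₀ := lt_min (by norm_num) hcpos
  have hs₀le : s₀ ≤ 1 / 4 := min_le_left _ _
  have hs₀c : s₀ ≤ c := min_le_right _ _
  -- `b ∈ A` uniformly `s₀`-close to `g`
  obtain ⟨b, hbA, hb⟩ := Metric.mem_closure_iff.1 (hd g) s₀ hs₀pos
  have hbg : ∀ x, |b x - g x| ≤ s₀ := fun x => by
    have h := (b - g).norm_coe_le_norm x
    rw [ContinuousMap.sub_apply, Real.norm_eq_abs] at h
    refine h.trans ?_
    rw [← dist_eq_norm, dist_comm]
    exact hb.le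
  have hqi : Integrable (sqKernel b) (haarProbability Ω) :=
    integrable_of_continuous_compact (continuous_sqKernel b) _
  -- lower bound for the mass: `q ≥ 1/16` on `V`
  have hlow : (haarProbability Ω).real V / 16 ≤ ∫ w, sqKernel b w ∂haarProbability Ω := by
    have h1 : ∫ w in V, (1 / 16 : ℝ) ∂haarProbability Ω ≤ ∫ w in V, sqKernel b w ∂haarProbability Ω := by
      refine setIntegral_mono_on (integrable_const _).integrableOn hqi.integrableOn hVo.measurableSet
        fun w hw => ?_
      have hw' : (1 / 2 : ℝ) < g w⁻¹ := hw
      have hb' : 1 / 4 ≤ b w⁻¹ := by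
        have h := hbg w⁻¹
        rw [abs_le] at h
        linarith
      calc (1 / 16 : ℝ) = (1 / 4) ^ 2 := by norm_num
        _ ≤ (b w⁻¹) ^ 2 := pow_le_pow_left₀ (by norm_num) hb' 2
    have h2 : ∫ w in V, sqKernel b w ∂haarProbability Ω ≤ ∫ w, sqKernel b w ∂haarProbability Ω :=
      setIntegral_le_integral hqi (ae_of_all _ (sqKernel_nonneg b))
    rw [setIntegral_const, smul_eq_mul] at h1
    linarith
  -- upper bound for the tail: `q ≤ s₀²` off `U`
  have htail : ∫ w in Uᶜ, sqKernel b w ∂haarProbability Ω ≤ s₀ ^ 2 := by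
    have h1 : ∫ w in Uᶜ, sqKernel b w ∂haarProbability Ω ≤ ∫ w in Uᶜ, s₀ ^ 2 ∂haarProbability Ω := by
      refine setIntegral_mono_on hqi.integrableOn (integrable_const _).integrableOn
        hUo.isClosed_compl.measurableSet fun w hw => ?_
      have hw' : w⁻¹ ∉ interior U⁻¹ := fun h => hw (by
        have h' := interior_subset h
        simpa using h')
      have hg0' : g w⁻¹ = 0 := by simpa using hg0 hw'
      have hb0 : |b w⁻¹| ≤ s₀ := by simpa [hg0'] using hbg w⁻¹
      calc sqKernel b w = |b w⁻¹| ^ 2 := (sq_abs _).symm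
        _ ≤ s₀ ^ 2 := pow_le_pow_left₀ (abs_nonneg _) hb0 2
    have h2 : (haarProbability Ω).real Uᶜ ≤ 1 := by
      rw [measureReal_def]
      exact ENNReal.toReal_le_of_le_ofReal zero_le_one (by simpa using prob_le_one)
    rw [setIntegral_const, smul_eq_mul] at h1
    nlinarith [sq_nonneg s₀]
  refine ⟨b, hbA, lt_of_lt_of_le (by positivity) hlow, htail.trans ?_⟩
  have hcm : c ≤ t * ∫ w, sqKernel b w ∂haarProbability Ω := by
    rw [hc]
    have h := mul_le_mul_of_nonneg_left hlow ht.le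
    linarith
  nlinarith

/-! ## `φ(T_a f) ≈ (∫ q_a) φ f` for a concentrated bump -/

/-- **Approximation step.** For `f ∈ A` and `ε > 0` there is a bump `a ∈ A` with
`|φ(T_a f) - (∫ q_a) φ f| ≤ ε ∫ q_a`: right translation is continuous into `C(Ω, ℝ)`, `T_a f` and
`f` lie in the finite-dimensional translation-stable `W ∋ f` on which `φ` is continuous.
[folklore] -/
theorem exists_smooth_approx (hA : IsTranslationFinite A)
    (hd : ∀ f : C(Ω, ℝ), f ∈ closure (A : Set C(Ω, ℝ))) (φ : C(Ω, ℝ) →ₗ[ℝ] ℝ) {f : C(Ω, ℝ)}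
    (hf : f ∈ A) {ε : ℝ} (hε : 0 < ε) :
    ∃ a ∈ A, 0 < ∫ w, sqKernel a w ∂haarProbability Ω ∧
      |φ (smooth a f) - (∫ w, sqKernel a w ∂haarProbability Ω) * φ f| ≤
        ε * ∫ w, sqKernel a w ∂haarProbability Ω := by
  obtain ⟨W, hWfg, -, hfW, hW⟩ := hA f hf
  obtain ⟨ψ, hψ⟩ := exists_clm_eqOn_of_fg φ hWfg
  set η : ℝ := ε / (‖ψ‖ + 1) with hη
  have hηpos : 0 < η := div_pos hε (by positivity)
  have hηε : ‖ψ‖ * η ≤ ε := by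
    rw [hη, mul_div_assoc', div_le_iff₀ (by positivity)]
    nlinarith [norm_nonneg ψ]
  -- uniform continuity of the right translation at `1`
  have hcont : Continuous fun w : Ω => f.comp (transCM ((1 : Ω), w)) :=
    (continuous_comp_actCM continuous_transAct f).comp (continuous_const.prodMk continuous_id)
  have h11 : f.comp (transCM ((1 : Ω), (1 : Ω))) = f := by
    ext x; simp
  obtain ⟨U, hUo, h1U, hUf⟩ : ∃ U : Set Ω, IsOpen U ∧ (1 : Ω) ∈ U ∧
      ∀ w ∈ U, ‖f.comp (transCM ((1 : Ω), w)) - f‖ ≤ η / 2 := by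
    have h := Metric.tendsto_nhds.1 (hcont.tendsto 1) (η / 2) (by positivity)
    rw [h11] at h
    obtain ⟨U, hUsub, hUo, h1U⟩ := mem_nhds_iff.1 h
    exact ⟨U, hUo, h1U, fun w hw => by
      rw [← dist_eq_norm]
      exact (hUsub hw).le⟩
  -- the bump
  obtain ⟨a, haA, hm, htail⟩ :=
    exists_sqKernel_concentrated hd hUo h1U (t := η / (4 * (‖f‖ + 1))) (by positivity)
  set m := ∫ w, sqKernel a w ∂haarProbability Ω with hmdef
  refine ⟨a, haA, hm, ?_⟩
  have hq0 := sqKernel_nonneg a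
  have hqi : Integrable (sqKernel a) (haarProbability Ω) :=
    integrable_of_continuous_compact (continuous_sqKernel a) _
  -- `‖T_a f - m • f‖ ≤ η m`
  have hdiff : smooth a f - m • f =
      ∫ w, sqKernel a w • (f.comp (transCM ((1 : Ω), w)) - f) ∂haarProbability Ω := by
    simp_rw [smul_sub]
    rw [integral_sub (integrable_of_continuous_compact (continuous_smooth_integrand a f) _)
      (hqi.smul_const f), integral_smul_const]
    rfl
  have hbound : ‖smooth a f - m • f‖ ≤ η * m := by
    rw [hdiff]
    calc ‖∫ w, sqKernel a w • (f.comp (transCM ((1 : Ω), w)) - f) ∂haarProbability Ω‖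
        ≤ ∫ w, (sqKernel a w * (η / 2) + Uᶜ.indicator (sqKernel a) w * (2 * ‖f‖)) ∂haarProbability Ω := by
          refine norm_integral_le_of_norm_le ((hqi.mul_const _).add
            ((hqi.indicator hUo.isClosed_compl.measurableSet).mul_const _)) (ae_of_all _ fun w => ?_)
          rw [norm_smul, Real.norm_eq_abs, abs_of_nonneg (hq0 w)]
          by_cases hw : w ∈ U
          · rw [Set.indicator_of_notMem (fun h : w ∈ Uᶜ => h hw), zero_mul, add_zero]
            exact mul_le_mul_of_nonneg_left (hUf w hw) (hq0 w)
          · rw [Set.indicator_of_mem hw]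
            have h2 : ‖f.comp (transCM ((1 : Ω), w)) - f‖ ≤ 2 * ‖f‖ :=
              (norm_sub_le _ _).trans (by linarith [norm_comp_le f (transCM ((1 : Ω), w))])
            nlinarith [hq0 w, norm_nonneg (f.comp (transCM ((1 : Ω), w)) - f)]
      _ = (η / 2) * m + (2 * ‖f‖) * ∫ w in Uᶜ, sqKernel a w ∂haarProbability Ω := by
          rw [integral_add (hqi.mul_const _) ((hqi.indicator hUo.isClosed_compl.measurableSet).mul_const _),
            integral_mul_const, integral_mul_const, integral_indicator hUo.isClosed_compl.measurableSet]
          ring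
      _ ≤ (η / 2) * m + (2 * ‖f‖) * (η / (4 * (‖f‖ + 1)) * m) := by gcongr
      _ ≤ η * m := by
          have h3 : 2 * ‖f‖ * (η / (4 * (‖f‖ + 1))) ≤ η / 2 := by
            rw [mul_div_assoc', div_le_iff₀ (by positivity)]
            nlinarith [norm_nonneg f]
          nlinarith [hm.le]
  -- `φ` agrees with the continuous `ψ` on `W ∋ T_a f, f`
  have hTmem : smooth a f ∈ W := smooth_mem hWfg hW a hfW
  have hφ : φ (smooth a f) - m * φ f = ψ (smooth a f - m • f) := by
    rw [map_sub, map_smul, hψ _ hTmem, hψ _ hfW, smul_eq_mul]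
  rw [hφ]
  calc |ψ (smooth a f - m • f)| ≤ ‖ψ‖ * ‖smooth a f - m • f‖ := by
        rw [← Real.norm_eq_abs]; exact ψ.le_opNorm _
    _ ≤ ‖ψ‖ * (η * m) := by gcongr
    _ = (‖ψ‖ * η) * m := by ring
    _ ≤ ε * m := mul_le_mul_of_nonneg_right hηε hm.le

/-! ## Main theorem: `inf f ≤ φ f ≤ sup f` -/

/-- ★★ **A normalised square-positive functional is bounded below by the infimum**: `Ω` compact
group, `A ≤ C(Ω, ℝ)` dense and translation finite, `φ 1 = 1`, `0 ≤ φ (a a)` for `a ∈ A`; then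
`c ≤ f` pointwise implies `c ≤ φ f` for every `f ∈ A`. [folklore] -/
theorem le_of_sqPositive (hA : IsTranslationFinite A)
    (hd : ∀ f : C(Ω, ℝ), f ∈ closure (A : Set C(Ω, ℝ))) {φ : C(Ω, ℝ) →ₗ[ℝ] ℝ} (h1 : φ 1 = 1)
    (hpos : ∀ a ∈ A, 0 ≤ φ (a * a)) {f : C(Ω, ℝ)} (hf : f ∈ A) {c : ℝ} (hc : ∀ x, c ≤ f x) :
    c ≤ φ f := by
  by_contra hlt
  push Not at hlt
  obtain ⟨a, haA, hm, happrox⟩ := exists_smooth_approx hA hd φ hf (ε := (c - φ f) / 2) (by linarith)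
  set m := ∫ w, sqKernel a w ∂haarProbability Ω with hmdef
  obtain ⟨W, hWfg, -, haW, hW⟩ := hA (a * a) (A.mul_mem haA haA)
  have hrep := integral_mul_sqDensity φ hWfg hW haW f
  have hP0 := sqDensity_nonneg hA hpos haA
  have hPc := continuous_sqDensity φ hWfg hW haW
  have hPint := integral_sqDensity φ hWfg hW haW
  rw [h1, mul_one] at hPint
  -- `c m ≤ ∫ f P = φ (T_a f)`
  have hcm : c * m ≤ φ (smooth a f) := by
    rw [← hrep, hmdef, ← hPint, ← integral_const_mul]
    exact integral_mono (integrable_of_continuous_compact (continuous_const.mul hPc) _)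
      (integrable_of_continuous_compact (f.continuous.mul hPc) _)
      fun z => mul_le_mul_of_nonneg_right (hc z) (hP0 z)
  have h2 := (abs_le.1 happrox).2
  nlinarith

/-- ★★ **… and above by the supremum.** [folklore] -/
theorem sqPositive_le (hA : IsTranslationFinite A)
    (hd : ∀ f : C(Ω, ℝ), f ∈ closure (A : Set C(Ω, ℝ))) {φ : C(Ω, ℝ) →ₗ[ℝ] ℝ} (h1 : φ 1 = 1)
    (hpos : ∀ a ∈ A, 0 ≤ φ (a * a)) {f : C(Ω, ℝ)} (hf : f ∈ A) {c : ℝ} (hc : ∀ x, f x ≤ c) :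
    φ f ≤ c := by
  have h := le_of_sqPositive hA hd h1 hpos (neg_mem hf) (c := -c) fun x => by
    simpa using neg_le_neg (hc x)
  rw [map_neg] at h
  linarith

/-- ★★ **Automatic continuity**: `|φ f| ≤ ‖f‖` on `A`. [folklore] -/
theorem abs_le_norm_of_sqPositive (hA : IsTranslationFinite A)
    (hd : ∀ f : C(Ω, ℝ), f ∈ closure (A : Set C(Ω, ℝ))) {φ : C(Ω, ℝ) →ₗ[ℝ] ℝ} (h1 : φ 1 = 1)
    (hpos : ∀ a ∈ A, 0 ≤ φ (a * a)) {f : C(Ω, ℝ)} (hf : f ∈ A) : |φ f| ≤ ‖f‖ :=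
  abs_le.2
    ⟨le_of_sqPositive hA hd h1 hpos hf fun x => (abs_le.1 (by
        simpa only [Real.norm_eq_abs] using f.norm_coe_le_norm x)).1,
      sqPositive_le hA hd h1 hpos hf fun x => (abs_le.1 (by
        simpa only [Real.norm_eq_abs] using f.norm_coe_le_norm x)).2⟩

/-- ★★ **Positivity**: `0 ≤ f` pointwise implies `0 ≤ φ f` on `A`. [folklore] -/
theorem nonneg_of_sqPositive (hA : IsTranslationFinite A)
    (hd : ∀ f : C(Ω, ℝ), f ∈ closure (A : Set C(Ω, ℝ))) {φ : C(Ω, ℝ) →ₗ[ℝ] ℝ} (h1 : φ 1 = 1)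
    (hpos : ∀ a ∈ A, 0 ≤ φ (a * a)) {f : C(Ω, ℝ)} (hf : f ∈ A) (hf0 : ∀ x, 0 ≤ f x) : 0 ≤ φ f :=
  le_of_sqPositive hA hd h1 hpos hf hf0

end Summit.QuantumFields.GaugeBoot

end
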